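import Summits.QuantumFields.BalabanUV.Beta.WardLocusRecursiveAll
import Summits.QuantumFields.BalabanUV.Beta.WardLocusResidualWall

/-!
# `BalabanUV.Beta.WardLocusRecursiveLetters` — binder row D1, (L4) W-side of hW, «D1-hW-L4-WARD-ALL» FINAL part: THE ALL-LEVELS WARD KERNEL LAW OF THE
# W-LITERAL `WrecAt` FROM THE LETTERS, and hW(v2.26-W) FROM THE LETTERS — by ONE induction over the levels carrying (kernel law, residual class, residual
# parity): parts A (`WardLocusQuarticTable`), B (`WardLocusRecursiveStep`), C (`WardLocusRecursiveAll`), Q1/Q2 (`WardLocusResidualClass`/`…Wall`) composed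
# (β sub-cell, D1 formalisation swarm, unit `b2b-balaban-beta-d1-formalise-leaf-06`, gen 3; CLAIM «D1-hW-L4-WARD-ALL» journal 2026-08-20)

NOT IN PRINT; OUR BOOKKEEPING.  HONEST FRAMING (cell charter, verbatim): «discharging `BetaPertH` makes Bałaban's UV stability UNCONDITIONAL — a real
constructive-QFT result; it is NOT the continuum limit and NOT the Clay problem.»  HONEST DEPENDENCY (verbatim): «continuum YM on T⁴ ⇐ BetaPertH ∧ nine spine
estimates (0/9 proved); BetaPertH ⇐ (D1) ∧ (D4) ∧ CAP+tail; G-an2-4 gates asym, D1 and NE2/3/4.»  [folklore] composition; the LETTERS — an1's BORDER Ward law of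
the `vh₂S` sector in both slots at every level `j ≥ 0`, an1's MIXED Ward law of `M2Of mixFF j` at every level, the level-0 WILSON Ward law of `cE₂ • wilsonW₂ d T`
(for `T := wsym22 N`: leaf-09-g4's `WilsonBiStencilWardSocket.hS₂_wilson`) — with their remainders' classes (one rate per level, w.l.o.g.) and row parities, the pin
`cE₂ = Lc^{2(d+1)}` ((W-L-2), (R45)/(P6)) and the binder tables' block covariances are DISPLAYED HYPOTHESES; no statement of Bałaban's papers, no `[cite:]`, no
`def`, no `def … : Prop`; instantiates NO binder of the β-function wall.  hW is REDUCED TO LETTERS here, NOT discharged; NOT D1, NOT `BetaPertH`, NOT continuum, NOT Clay.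

* §1 **`exists_kernelLaws_of_letters`** (generic `d`, in-block root, hW Ward pin): there is a residual family `Nr : ℕ → …` (built by recursion on the level from the
  letters' remainders: level 0 = part C §1's residual, level `j+1` = part C §2's residual over `Nr j`) such that for EVERY `j`: (class) `Nr j y` is a vertex family
  in `(ν, y′)` uniformly in `y`; (parity) its rows are parity-odd; (law) `divW (WrecAt j) y ν y′ = conjV (dM G_j Lc (SpureRecAt j) (M1At j) ν y′) (X y) + Nr j y ν y′`.
* §2 **`wardTransversal_flipK_TbalOf_JsRecWAtOf_of_letters`** (`d = 3`): **hW(v2.26-W) = `∀ j, WardTransversal (flipK (TbalOf Lc (JsRecWAtOf hLc hr Lc⁴ (−Lc⁴·½·Lc⁴) cΛ cE₂ cB T hB hmix) j))`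
  ⟸ EXACTLY the letters + the pin + `hBt`/`hmixt`** (§1 ∘ part B §3).  The hW twin of an2-g18's `SpineRecursiveT2All.…_JsRecWAtOf_of_letters`.
Provenance: D1 formalisation swarm, leaf prover 06 (gen 3), 2026-08-20; no existing file touched.
-/

noncomputable section

open Finset
open scoped BigOperators
open Literature.MathematicalPhysics.QuantumFieldTheory
open Literature.MathematicalPhysics.QuantumFieldTheory.Balaban1983to89
open Literature.MathematicalPhysics.QuantumFieldTheory.Balaban1983to89.Beta
open B12Sec2to5 (l1 l1_nonneg)
open ExpKernelCalculus (MKer Decays BiLoc VertexFamily VertexFamily₂ comp shiftK)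
open KernelWard (divV divW bdd_of_biLoc)
open AffineAveraging (Site box toSite)
open OneStepResolventKernel (Fib wsum LocStencil biLoc_mono)
open OneStepKernelFamily (KInvStep colH vertexOfK TbalOf flipK)
open InterLevelTransport (cwsum)
open PolarizationSign (WardTransversal)
open BalabanStepJetsSucc (mmRead wE wVH)
open SecondOrderResponse (colM vertexOfM dM LocStencilFM)
open BalabanCompositeJets (LocStencil₂)
open BalabanStepW2 (M2Of wV4 wB2)
open StepJetData (wilsonA locStencil_add)
open WilsonBiStencil (wilsonW₂)
open AveragingHessianKernelsRooted (vhSAt)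
open Summit.QuantumFields.BalabanUV.Beta.TameKernelCalculus
open Summit.QuantumFields.BalabanUV.Beta.ChartConjugation (conjV)
open Summit.QuantumFields.BalabanUV.Beta.BorderedHessian (diagK stepScale sgnK)
open Summit.QuantumFields.BalabanUV.Beta.AveragingWardRootedStencils (legInd)
open Summit.QuantumFields.BalabanUV.Beta.AxialDressingRooted (coDressKBmAt)
open Summit.QuantumFields.BalabanUV.Beta.SpineRooted (SpureRecAt M1At T2RecAt WrecAt JsRecWAtOf)
open Summit.QuantumFields.BalabanUV.Beta.KernelWardRelative (gaugeWt)
open Summit.QuantumFields.BalabanUV.Beta.WardLocusRecursiveAll (divW_WrecAt_zero_of_letters divW_WrecAt_succ_of_kernelLaw)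
open Summit.QuantumFields.BalabanUV.Beta.WardLocusResidualWall (exists_vertexFamily_residual_wall parityOdd_residual_wall exists_locStencil_transport_wall
  exists_bound_transport_wall parityOdd_transport_wall)
open Summit.QuantumFields.BalabanUV.Beta.WardLocusRecursiveStep (wardTransversal_flipK_TbalOf_JsRecWAtOf_of_kernelLaws)
open Summit.QuantumFields.BalabanUV.Beta.KernelWardRemainderParity (parityOdd_add)

namespace Summit.QuantumFields.BalabanUV.Beta.WardLocusRecursiveLetters

section Wall

variable {d Lc : ℕ} [NeZero Lc]

/-! ## §1 The all-levels kernel law with a classified, parity-odd residual, from the letters -/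

/-- [folklore] **THE WARD KERNEL LAW OF THE W-LITERAL AT EVERY LEVEL, FROM THE LETTERS** (in-block root `ρ = toSite r`, hW Ward pin
`(cE, cVH) = (Lc^{d+1}, −Lc^{d+1}·½·Lc^{d+1})`, generator `X y = diagK (½ • Σ_v legInd ρ (Lc•y+v))`, pin `cE₂ = Lc^{2(d+1)}`).  From the border letters (both slots,
every level), the mixed letters (every level), the level-0 Wilson letters — remainders classified with one rate per level and row-parity-odd — there is a residual
family `Nr` with, for EVERY `j`: a uniform vertex-family class, parity-odd rows, and the kernel law `divW (WrecAt j) y ν y′ = conjV (dM G_j …) (X y) + Nr j y ν y′`.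
Proof: `Nr` by recursion on `j` (level 0: part C §1's residual; step: part C §2's residual over `Nr j`); ONE induction carrying (class ∧ parity ∧ law) with parts C, Q2. -/
theorem exists_kernelLaws_of_letters (hLc : 1 ≤ Lc) {r : Fin (d + 1) → ℕ} (hr : r ∈ box (d + 1) Lc) (cΛ cB : ℝ) {cE₂ : ℝ}
    (hcE₂ : cE₂ = (Lc : ℝ) ^ (2 * (d + 1))) (T : Fin 4 → Fin 4 → Fin 4 → Fin 4 → ℝ)
    {vh₂S : Fin (d + 1) → (Fin (d + 1) → ℤ) → Fin (d + 1) → (Fin (d + 1) → ℤ) → MKer (d + 1) (Fib d)}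
    (hB : ∃ C δ : ℝ, 0 < δ ∧ LocStencil₂ vh₂S C δ)
    {mixFF : Fin (d + 1) → (Fin (d + 1) → ℤ) → Fin (d + 1) → (Fin (d + 1) → ℤ) → MKer (d + 1) (Fib d)}
    (hmix : ∃ C δ : ℝ, 0 < δ ∧ LocStencilFM Lc mixFF C δ)
    -- the LETTERS' remainders (an1's border law both slots ∀ j ≥ 0, an1's mixed law ∀ j, the level-0 Wilson law), their classes (one rate per level) and row parities
    {RW RW'' : (Fin (d + 1) → ℤ) → Fin (d + 1) → (Fin (d + 1) → ℤ) → MKer (d + 1) (Fib d)} {RB RB'' : ℕ → (Fin (d + 1) → ℤ) → Fin (d + 1) → (Fin (d + 1) → ℤ) → MKer (d + 1) (Fib d)} {RM : ℕ → (Fin (d + 1) → ℤ) → Fin (d + 1) → (Fin (d + 1) → ℤ) → MKer (d + 1) (Fib d)}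
    (hcls0 : ∃ C δ : ℝ, 0 < δ ∧ (∀ Y, LocStencil (RW Y) C δ) ∧ (∀ Y, LocStencil (RW'' Y) C δ) ∧ (∀ Y, LocStencil (RB 0 Y) C δ) ∧
      (∀ Y, LocStencil (RB'' 0 Y) C δ) ∧ (∀ y, VertexFamily (RM 0 y) Lc C δ))
    (hclsS : ∀ j : ℕ, ∃ C δ : ℝ, 0 < δ ∧ (∀ Y, LocStencil (RB (j + 1) Y) C δ) ∧ (∀ Y, LocStencil (RB'' (j + 1) Y) C δ) ∧
      (∀ y, VertexFamily (RM (j + 1) y) Lc C δ))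
    (hRWp : ∀ Y κ u, trK (RW Y κ u) = -sgnK (RW Y κ u)) (hRW''p : ∀ Y κ u, trK (RW'' Y κ u) = -sgnK (RW'' Y κ u))
    (hRBp : ∀ j Y κ u, trK (RB j Y κ u) = -sgnK (RB j Y κ u)) (hRB''p : ∀ j Y κ u, trK (RB'' j Y κ u) = -sgnK (RB'' j Y κ u))
    (hRMp : ∀ j y ρ' w, trK (RM j y ρ' w) = -sgnK (RM j y ρ' w))
    (hWil : ∀ (Y : Fin (d + 1) → ℤ) (κ' : Fin (d + 1)) (u' : Fin (d + 1) → ℤ),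
      (stepScale d Lc 0 * (Lc : ℝ) ^ (d + 1))⁻¹ • ∑ v ∈ box (d + 1) Lc, divV (fun κ u => cE₂ • wilsonW₂ d T κ u κ' u') ((Lc : ℤ) • Y + toSite v) =
        comp (((Lc : ℝ) ^ (d + 1)) • wilsonA d κ' u') (diagK (((1 : ℝ) / 2) • ∑ v ∈ box (d + 1) Lc, legInd (toSite r) ((Lc : ℤ) • Y + toSite v)))
          - comp (diagK (((1 : ℝ) / 2) • ∑ v ∈ box (d + 1) Lc, legInd (toSite r) ((Lc : ℤ) • Y + toSite v))) (((Lc : ℝ) ^ (d + 1)) • wilsonA d κ' u')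
          + RW Y κ' u')
    (hWil'' : ∀ (Y : Fin (d + 1) → ℤ) (κ : Fin (d + 1)) (u : Fin (d + 1) → ℤ),
      (stepScale d Lc 0 * (Lc : ℝ) ^ (d + 1))⁻¹ • ∑ v ∈ box (d + 1) Lc, divV (fun κ' u' => cE₂ • wilsonW₂ d T κ u κ' u') ((Lc : ℤ) • Y + toSite v) =
        comp (((Lc : ℝ) ^ (d + 1)) • wilsonA d κ u) (diagK (((1 : ℝ) / 2) • ∑ v ∈ box (d + 1) Lc, legInd (toSite r) ((Lc : ℤ) • Y + toSite v)))
          - comp (diagK (((1 : ℝ) / 2) • ∑ v ∈ box (d + 1) Lc, legInd (toSite r) ((Lc : ℤ) • Y + toSite v))) (((Lc : ℝ) ^ (d + 1)) • wilsonA d κ u)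
          + RW'' Y κ u)
    (hBord0 : ∀ (Y : Fin (d + 1) → ℤ) (κ' : Fin (d + 1)) (u' : Fin (d + 1) → ℤ),
      (stepScale d Lc 0 * (Lc : ℝ) ^ (d + 1))⁻¹ • ∑ v ∈ box (d + 1) Lc, divV (fun κ u => cB • vh₂S κ u κ' u') ((Lc : ℤ) • Y + toSite v) =
        comp ((-((Lc : ℝ) ^ (d + 1) * (1 / 2) * (Lc : ℝ) ^ (d + 1))) • vhSAt (toSite r) d Lc rfl κ' u') (diagK (((1 : ℝ) / 2) • ∑ v ∈ box (d + 1) Lc, legInd (toSite r) ((Lc : ℤ) • Y + toSite v)))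
          - comp (diagK (((1 : ℝ) / 2) • ∑ v ∈ box (d + 1) Lc, legInd (toSite r) ((Lc : ℤ) • Y + toSite v))) ((-((Lc : ℝ) ^ (d + 1) * (1 / 2) * (Lc : ℝ) ^ (d + 1))) • vhSAt (toSite r) d Lc rfl κ' u')
          + RB 0 Y κ' u')
    (hBord0'' : ∀ (Y : Fin (d + 1) → ℤ) (κ : Fin (d + 1)) (u : Fin (d + 1) → ℤ),
      (stepScale d Lc 0 * (Lc : ℝ) ^ (d + 1))⁻¹ • ∑ v ∈ box (d + 1) Lc, divV (fun κ' u' => cB • vh₂S κ u κ' u') ((Lc : ℤ) • Y + toSite v) =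
        comp ((-((Lc : ℝ) ^ (d + 1) * (1 / 2) * (Lc : ℝ) ^ (d + 1))) • vhSAt (toSite r) d Lc rfl κ u) (diagK (((1 : ℝ) / 2) • ∑ v ∈ box (d + 1) Lc, legInd (toSite r) ((Lc : ℤ) • Y + toSite v)))
          - comp (diagK (((1 : ℝ) / 2) • ∑ v ∈ box (d + 1) Lc, legInd (toSite r) ((Lc : ℤ) • Y + toSite v))) ((-((Lc : ℝ) ^ (d + 1) * (1 / 2) * (Lc : ℝ) ^ (d + 1))) • vhSAt (toSite r) d Lc rfl κ u)
          + RB'' 0 Y κ u)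
    (hBordS : ∀ (j : ℕ) (Y : Fin (d + 1) → ℤ) (κ' : Fin (d + 1)) (u' : Fin (d + 1) → ℤ),
      (stepScale d Lc (j + 1) * (Lc : ℝ) ^ (d + 1))⁻¹ •
          ∑ v ∈ box (d + 1) Lc, divV (fun κ u => (cB * wB2 d Lc (j + 1)) • vh₂S κ u κ' u') ((Lc : ℤ) • Y + toSite v) =
        comp ((-((Lc : ℝ) ^ (d + 1) * (1 / 2) * (Lc : ℝ) ^ (d + 1)) * wVH d Lc (j + 1)) • vhSAt (toSite r) d Lc rfl κ' u') (diagK (((1 : ℝ) / 2) • ∑ v ∈ box (d + 1) Lc, legInd (toSite r) ((Lc : ℤ) • Y + toSite v)))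
          - comp (diagK (((1 : ℝ) / 2) • ∑ v ∈ box (d + 1) Lc, legInd (toSite r) ((Lc : ℤ) • Y + toSite v))) ((-((Lc : ℝ) ^ (d + 1) * (1 / 2) * (Lc : ℝ) ^ (d + 1)) * wVH d Lc (j + 1)) • vhSAt (toSite r) d Lc rfl κ' u')
          + RB (j + 1) Y κ' u')
    (hBordS'' : ∀ (j : ℕ) (Y : Fin (d + 1) → ℤ) (κ : Fin (d + 1)) (u : Fin (d + 1) → ℤ),
      (stepScale d Lc (j + 1) * (Lc : ℝ) ^ (d + 1))⁻¹ •
          ∑ v ∈ box (d + 1) Lc, divV (fun κ' u' => (cB * wB2 d Lc (j + 1)) • vh₂S κ u κ' u') ((Lc : ℤ) • Y + toSite v) =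
        comp ((-((Lc : ℝ) ^ (d + 1) * (1 / 2) * (Lc : ℝ) ^ (d + 1)) * wVH d Lc (j + 1)) • vhSAt (toSite r) d Lc rfl κ u) (diagK (((1 : ℝ) / 2) • ∑ v ∈ box (d + 1) Lc, legInd (toSite r) ((Lc : ℤ) • Y + toSite v)))
          - comp (diagK (((1 : ℝ) / 2) • ∑ v ∈ box (d + 1) Lc, legInd (toSite r) ((Lc : ℤ) • Y + toSite v))) ((-((Lc : ℝ) ^ (d + 1) * (1 / 2) * (Lc : ℝ) ^ (d + 1)) * wVH d Lc (j + 1)) • vhSAt (toSite r) d Lc rfl κ u)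
          + RB'' (j + 1) Y κ u)
    (hM₂ : ∀ (j : ℕ) (y : Fin (d + 1) → ℤ) (ρ' : Fin (d + 1)) (w : Fin (d + 1) → ℤ),
      (stepScale d Lc j * (Lc : ℝ) ^ (d + 1))⁻¹ • ∑ v ∈ box (d + 1) Lc, divV (fun κ u => M2Of d Lc mixFF j κ u ρ' w) ((Lc : ℤ) • y + toSite v) =
        comp (M1At d Lc (toSite r) cΛ j ρ' w) (diagK (((1 : ℝ) / 2) • ∑ v ∈ box (d + 1) Lc, legInd (toSite r) ((Lc : ℤ) • y + toSite v)))
          - comp (diagK (((1 : ℝ) / 2) • ∑ v ∈ box (d + 1) Lc, legInd (toSite r) ((Lc : ℤ) • y + toSite v))) (M1At d Lc (toSite r) cΛ j ρ' w)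
          + RM j y ρ' w) :
    ∃ Nr : ℕ → (Fin (d + 1) → ℤ) → Fin (d + 1) → (Fin (d + 1) → ℤ) → MKer (d + 1) (Fib d),
      (∀ j, ∃ C δ : ℝ, 0 < δ ∧ ∀ y, VertexFamily (Nr j y) Lc C δ) ∧
      (∀ j y ν y', trK (Nr j y ν y') = -sgnK (Nr j y ν y')) ∧
      (∀ (j : ℕ) (y : Fin (d + 1) → ℤ) (ν : Fin (d + 1)) (y' : Fin (d + 1) → ℤ),
        divW (WrecAt d Lc (toSite r) ((Lc : ℝ) ^ (d + 1)) (-((Lc : ℝ) ^ (d + 1) * (1 / 2) * (Lc : ℝ) ^ (d + 1))) cΛ cE₂ cB T vh₂S mixFF j) y ν y' =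
          conjV (dM (coDressKBmAt (toSite r) Lc (KInvStep (d := d) Lc j)) Lc
            (SpureRecAt d Lc (toSite r) ((Lc : ℝ) ^ (d + 1)) (-((Lc : ℝ) ^ (d + 1) * (1 / 2) * (Lc : ℝ) ^ (d + 1))) cΛ j)
            (M1At d Lc (toSite r) cΛ j) ν y')
          (diagK (((1 : ℝ) / 2) • ∑ v ∈ box (d + 1) Lc, legInd (toSite r) ((Lc : ℤ) • y + toSite v))) + Nr j y ν y') := by
  -- the residual family, by recursion on the level
  let N0 : (Fin (d + 1) → ℤ) → Fin (d + 1) → (Fin (d + 1) → ℤ) → MKer (d + 1) (Fib d) := fun y ν y' =>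
    (1 / 2 : ℝ) • (
              (dM (coDressKBmAt (toSite r) Lc (KInvStep (d := d) Lc 0)) Lc (fun κ u => RW y κ u + RB 0 y κ u) (RM 0 y) ν y'
                - (stepScale d Lc 0 * (Lc : ℝ) ^ (d + 1))⁻¹ • (∑ κ, wsum (fun u => ∑' x₂, ∑ κ₂,
                    comp (coDressKBmAt (toSite r) Lc (KInvStep (d := d) Lc 0))
                      (dM (coDressKBmAt (toSite r) Lc (KInvStep (d := d) Lc 0)) Lc
                        (SpureRecAt d Lc (toSite r) ((Lc : ℝ) ^ (d + 1)) (-((Lc : ℝ) ^ (d + 1) * (1 / 2) * (Lc : ℝ) ^ (d + 1))) cΛ 0)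
                        (M1At d Lc (toSite r) cΛ 0) ν y') u x₂ (Sum.inl κ) (Sum.inl κ₂) * gaugeWt Lc y κ₂ x₂)
                    (SpureRecAt d Lc (toSite r) ((Lc : ℝ) ^ (d + 1)) (-((Lc : ℝ) ^ (d + 1) * (1 / 2) * (Lc : ℝ) ^ (d + 1))) cΛ 0 κ)
                  + ∑ ρ', cwsum Lc (fun w => ∑' x₂, ∑ κ₂,
                    comp (coDressKBmAt (toSite r) Lc (KInvStep (d := d) Lc 0))
                      (dM (coDressKBmAt (toSite r) Lc (KInvStep (d := d) Lc 0)) Lc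
                        (SpureRecAt d Lc (toSite r) ((Lc : ℝ) ^ (d + 1)) (-((Lc : ℝ) ^ (d + 1) * (1 / 2) * (Lc : ℝ) ^ (d + 1))) cΛ 0)
                        (M1At d Lc (toSite r) cΛ 0) ν y') ((Lc : ℤ) • w) x₂ (Sum.inr ρ') (Sum.inl κ₂) * gaugeWt Lc y κ₂ x₂)
                    (M1At d Lc (toSite r) cΛ 0 ρ')))
              + (dM (coDressKBmAt (toSite r) Lc (KInvStep (d := d) Lc 0)) Lc (fun κ u => RW'' y κ u + RB'' 0 y κ u) (RM 0 y) ν y'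
                + dM (conjV (coDressKBmAt (toSite r) Lc (KInvStep (d := d) Lc 0))
                    (diagK (((1 : ℝ) / 2) • ∑ v ∈ box (d + 1) Lc, legInd (toSite r) ((Lc : ℤ) • y + toSite v)))) Lc
                  (SpureRecAt d Lc (toSite r) ((Lc : ℝ) ^ (d + 1)) (-((Lc : ℝ) ^ (d + 1) * (1 / 2) * (Lc : ℝ) ^ (d + 1))) cΛ 0)
                  (M1At d Lc (toSite r) cΛ 0) ν y'))
  let NS : ℕ → ((Fin (d + 1) → ℤ) → Fin (d + 1) → (Fin (d + 1) → ℤ) → MKer (d + 1) (Fib d)) → (Fin (d + 1) → ℤ) → Fin (d + 1) → (Fin (d + 1) → ℤ) → MKer (d + 1) (Fib d) := fun j 𝒩 => fun y ν y' =>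
    (1 / 2 : ℝ) • (
              (dM (coDressKBmAt (toSite r) Lc (KInvStep (d := d) Lc (j + 1))) Lc
                  (fun κ' u' => -((stepScale d Lc (j + 1) * (Lc : ℝ) ^ (d + 1))⁻¹ * (cE₂ * wV4 d Lc (j + 1))) •
                      ∑ v ∈ box (d + 1) Lc, mmRead Lc (comp (comp (coDressKBmAt (toSite r) Lc (KInvStep (d := d) Lc j))
                        (𝒩 ((Lc : ℤ) • y + toSite v) κ' u')) (coDressKBmAt (toSite r) Lc (KInvStep (d := d) Lc j)))
                    + RB (j + 1) y κ' u') (RM (j + 1) y) ν y'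
                - (stepScale d Lc (j + 1) * (Lc : ℝ) ^ (d + 1))⁻¹ • (∑ κ, wsum (fun u => ∑' x₂, ∑ κ₂,
                    comp (coDressKBmAt (toSite r) Lc (KInvStep (d := d) Lc (j + 1)))
                      (dM (coDressKBmAt (toSite r) Lc (KInvStep (d := d) Lc (j + 1))) Lc
                        (SpureRecAt d Lc (toSite r) ((Lc : ℝ) ^ (d + 1)) (-((Lc : ℝ) ^ (d + 1) * (1 / 2) * (Lc : ℝ) ^ (d + 1))) cΛ (j + 1))
                        (M1At d Lc (toSite r) cΛ (j + 1)) ν y') u x₂ (Sum.inl κ) (Sum.inl κ₂) * gaugeWt Lc y κ₂ x₂)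
                    (SpureRecAt d Lc (toSite r) ((Lc : ℝ) ^ (d + 1)) (-((Lc : ℝ) ^ (d + 1) * (1 / 2) * (Lc : ℝ) ^ (d + 1))) cΛ (j + 1) κ)
                  + ∑ ρ', cwsum Lc (fun w => ∑' x₂, ∑ κ₂,
                    comp (coDressKBmAt (toSite r) Lc (KInvStep (d := d) Lc (j + 1)))
                      (dM (coDressKBmAt (toSite r) Lc (KInvStep (d := d) Lc (j + 1))) Lc
                        (SpureRecAt d Lc (toSite r) ((Lc : ℝ) ^ (d + 1)) (-((Lc : ℝ) ^ (d + 1) * (1 / 2) * (Lc : ℝ) ^ (d + 1))) cΛ (j + 1))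
                        (M1At d Lc (toSite r) cΛ (j + 1)) ν y') ((Lc : ℤ) • w) x₂ (Sum.inr ρ') (Sum.inl κ₂) * gaugeWt Lc y κ₂ x₂)
                    (M1At d Lc (toSite r) cΛ (j + 1) ρ')))
              + (dM (coDressKBmAt (toSite r) Lc (KInvStep (d := d) Lc (j + 1))) Lc
                  (fun κ u => -((stepScale d Lc (j + 1) * (Lc : ℝ) ^ (d + 1))⁻¹ * (cE₂ * wV4 d Lc (j + 1))) •
                      ∑ v ∈ box (d + 1) Lc, mmRead Lc (comp (comp (coDressKBmAt (toSite r) Lc (KInvStep (d := d) Lc j))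
                        (𝒩 ((Lc : ℤ) • y + toSite v) κ u)) (coDressKBmAt (toSite r) Lc (KInvStep (d := d) Lc j)))
                    + RB'' (j + 1) y κ u) (RM (j + 1) y) ν y'
                + dM (conjV (coDressKBmAt (toSite r) Lc (KInvStep (d := d) Lc (j + 1)))
                    (diagK (((1 : ℝ) / 2) • ∑ v ∈ box (d + 1) Lc, legInd (toSite r) ((Lc : ℤ) • y + toSite v)))) Lc
                  (SpureRecAt d Lc (toSite r) ((Lc : ℝ) ^ (d + 1)) (-((Lc : ℝ) ^ (d + 1) * (1 / 2) * (Lc : ℝ) ^ (d + 1))) cΛ (j + 1))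
                  (M1At d Lc (toSite r) cΛ (j + 1)) ν y'))
  let Nr : ℕ → (Fin (d + 1) → ℤ) → Fin (d + 1) → (Fin (d + 1) → ℤ) → MKer (d + 1) (Fib d) := fun j => Nat.rec N0 NS j
  have hNr0 : Nr 0 = N0 := rfl
  have hNrS : ∀ j, Nr (j + 1) = NS j (Nr j) := fun j => rfl
  refine ⟨Nr, ?_⟩
  -- ONE induction carrying class ∧ parity ∧ law
  have key : ∀ j : ℕ,
      (∃ C δ : ℝ, 0 < δ ∧ ∀ y, VertexFamily (Nr j y) Lc C δ) ∧
      (∀ y ν y', trK (Nr j y ν y') = -sgnK (Nr j y ν y')) ∧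
      (∀ (y : Fin (d + 1) → ℤ) (ν : Fin (d + 1)) (y' : Fin (d + 1) → ℤ),
        divW (WrecAt d Lc (toSite r) ((Lc : ℝ) ^ (d + 1)) (-((Lc : ℝ) ^ (d + 1) * (1 / 2) * (Lc : ℝ) ^ (d + 1))) cΛ cE₂ cB T vh₂S mixFF j) y ν y' =
          conjV (dM (coDressKBmAt (toSite r) Lc (KInvStep (d := d) Lc j)) Lc
            (SpureRecAt d Lc (toSite r) ((Lc : ℝ) ^ (d + 1)) (-((Lc : ℝ) ^ (d + 1) * (1 / 2) * (Lc : ℝ) ^ (d + 1))) cΛ j)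
            (M1At d Lc (toSite r) cΛ j) ν y')
          (diagK (((1 : ℝ) / 2) • ∑ v ∈ box (d + 1) Lc, legInd (toSite r) ((Lc : ℤ) • y + toSite v))) + Nr j y ν y') := by
    intro j
    induction j with
    | zero =>
      obtain ⟨C0, δ0, hδ0, hRWl, hRW''l, hRBl, hRB''l, hRMl⟩ := hcls0
      have hRl : ∀ Y, LocStencil (fun κ u => RW Y κ u + RB 0 Y κ u) (C0 + C0) δ0 := fun Y => locStencil_add (hRWl Y) (hRBl Y)
      have hR''l : ∀ Y, LocStencil (fun κ u => RW'' Y κ u + RB'' 0 Y κ u) (C0 + C0) δ0 := fun Y => locStencil_add (hRW''l Y) (hRB''l Y)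
      refine ⟨?_, ?_, ?_⟩
      · obtain ⟨C, δ, hδ, h⟩ := exists_vertexFamily_residual_wall hLc hr cΛ 0 (R := fun Y κ u => RW Y κ u + RB 0 Y κ u)
          (R'' := fun Y κ u => RW'' Y κ u + RB'' 0 Y κ u) (RM := RM 0) hδ0 hRl hδ0 hR''l hδ0 hRMl
        exact ⟨C, δ, hδ, fun y => by rw [hNr0]; exact h y⟩
      · intro y ν y'
        rw [hNr0]
        exact parityOdd_residual_wall hLc hr cΛ 0 (R := fun Y κ u => RW Y κ u + RB 0 Y κ u) (R'' := fun Y κ u => RW'' Y κ u + RB'' 0 Y κ u)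
          (RM := RM 0) (fun Y κ u => parityOdd_add (hRWp Y κ u) (hRBp 0 Y κ u)) (fun Y κ u => parityOdd_add (hRW''p Y κ u) (hRB''p 0 Y κ u))
          (hRMp 0) y ν y'
      · intro y ν y'
        rw [hNr0]
        exact divW_WrecAt_zero_of_letters hLc hr cΛ cE₂ cB T hB hmix
          (fun Y κ u x z a b => bdd_of_biLoc (hRWl Y κ u) hδ0.le x z a b) (fun Y κ u x z a b => bdd_of_biLoc (hRW''l Y κ u) hδ0.le x z a b)
          (fun Y κ u x z a b => bdd_of_biLoc (hRBl Y κ u) hδ0.le x z a b) (fun Y κ u x z a b => bdd_of_biLoc (hRB''l Y κ u) hδ0.le x z a b)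
          (fun y ρ' w x z a b => bdd_of_biLoc (hRMl y ρ' w) hδ0.le x z a b) hWil hWil'' hBord0 hBord0'' (hM₂ 0) y ν y'
    | succ j ih =>
      obtain ⟨⟨CN, δN, hδN, hcls⟩, hpar, hlaw⟩ := ih
      obtain ⟨CL, δL, hδL, hRBl, hRB''l, hRMl⟩ := hclsS j
      have h𝒩 : ∀ y ν y', Loc (Nr j y ν y') := fun y ν y' => ⟨_, _, _, δN, hδN, hcls y ν y'⟩
      obtain ⟨B𝒩, h𝒩b⟩ := exists_bound_transport_wall hLc hr j hδN hcls
      -- the two transported remainders of level j+1 (first and second slot) with their classes and parities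
      obtain ⟨CR, δR, hδR, hRl⟩ := exists_locStencil_transport_wall hLc hr j
        (-((stepScale d Lc (j + 1) * (Lc : ℝ) ^ (d + 1))⁻¹ * (cE₂ * wV4 d Lc (j + 1)))) hδN hcls hδL hRBl
      obtain ⟨CR'', δR'', hδR'', hR''l⟩ := exists_locStencil_transport_wall hLc hr j
        (-((stepScale d Lc (j + 1) * (Lc : ℝ) ^ (d + 1))⁻¹ * (cE₂ * wV4 d Lc (j + 1)))) hδN hcls hδL hRB''l
      have hRp := fun Y κ u => parityOdd_transport_wall hr j (-((stepScale d Lc (j + 1) * (Lc : ℝ) ^ (d + 1))⁻¹ * (cE₂ * wV4 d Lc (j + 1))))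
        h𝒩 hpar (hRBp (j + 1)) Y κ u
      have hR''p := fun Y κ u => parityOdd_transport_wall hr j (-((stepScale d Lc (j + 1) * (Lc : ℝ) ^ (d + 1))⁻¹ * (cE₂ * wV4 d Lc (j + 1))))
        h𝒩 hpar (hRB''p (j + 1)) Y κ u
      refine ⟨?_, ?_, ?_⟩
      · obtain ⟨C, δ, hδ, h⟩ := exists_vertexFamily_residual_wall hLc hr cΛ (j + 1) hδR hRl hδR'' hR''l hδL hRMl
        exact ⟨C, δ, hδ, fun y => by rw [hNrS]; exact h y⟩
      · intro y ν y'
        rw [hNrS]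
        exact parityOdd_residual_wall hLc hr cΛ (j + 1) hRp hR''p (hRMp (j + 1)) y ν y'
      · intro y ν y'
        rw [hNrS]
        exact divW_WrecAt_succ_of_kernelLaw hLc hr cΛ cB hcE₂ T hB hmix j h𝒩 hlaw h𝒩b h𝒩b
          (fun Y κ u x z a b => bdd_of_biLoc (hRBl Y κ u) hδL.le x z a b) (fun Y κ u x z a b => bdd_of_biLoc (hRB''l Y κ u) hδL.le x z a b)
          (hBordS j) (hBordS'' j) (fun y ρ' w x z a b => bdd_of_biLoc (hRMl y ρ' w) hδL.le x z a b) (hM₂ (j + 1)) y ν y'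
  exact ⟨fun j => (key j).1, fun j => (key j).2.1, fun j => (key j).2.2⟩

end Wall

/-! ## §2 hW(v2.26-W) from the letters (`d = 3`) -/

section End

variable {Lc : ℕ} [NeZero Lc]

/-- [folklore] **hW FOR THE RECURSIVE W-LITERAL FROM THE LETTERS** (`d = 3`, `Lc ≥ 1`, in-block root, hW Ward pin, pin `cE₂ = Lc⁸`): the border letters (both
slots, every level), the mixed letters (every level), the level-0 Wilson letters — with classified, row-parity-odd remainders — and the binder tables' block covariance
`hBt`/`hmixt` give `∀ j, WardTransversal (flipK (TbalOf Lc (JsRecWAtOf hLc hr Lc⁴ (−Lc⁴·½·Lc⁴) cΛ cE₂ cB T hB hmix) j))` — §1 ∘ part B §3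
(`WardLocusRecursiveStep.wardTransversal_flipK_TbalOf_JsRecWAtOf_of_kernelLaws`).  hW(v2.26-W) ⟸ EXACTLY the letters: REDUCED, not discharged. -/
theorem wardTransversal_flipK_TbalOf_JsRecWAtOf_of_letters (hLc : 1 ≤ Lc) {r : Fin (3 + 1) → ℕ} (hr : r ∈ box (3 + 1) Lc) (cΛ cB : ℝ) {cE₂ : ℝ}
    (hcE₂ : cE₂ = (Lc : ℝ) ^ (2 * (3 + 1))) (T : Fin 4 → Fin 4 → Fin 4 → Fin 4 → ℝ)
    {vh₂S : Fin (3 + 1) → (Fin (3 + 1) → ℤ) → Fin (3 + 1) → (Fin (3 + 1) → ℤ) → MKer (3 + 1) (Fib 3)}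
    (hB : ∃ C δ : ℝ, 0 < δ ∧ LocStencil₂ vh₂S C δ)
    {mixFF : Fin (3 + 1) → (Fin (3 + 1) → ℤ) → Fin (3 + 1) → (Fin (3 + 1) → ℤ) → MKer (3 + 1) (Fib 3)}
    (hmix : ∃ C δ : ℝ, 0 < δ ∧ LocStencilFM Lc mixFF C δ)
    -- the LETTERS' remainders (an1's border law both slots ∀ j ≥ 0, an1's mixed law ∀ j, the level-0 Wilson law), their classes (one rate per level) and row parities
    {RW RW'' : (Fin (3 + 1) → ℤ) → Fin (3 + 1) → (Fin (3 + 1) → ℤ) → MKer (3 + 1) (Fib 3)} {RB RB'' : ℕ → (Fin (3 + 1) → ℤ) → Fin (3 + 1) → (Fin (3 + 1) → ℤ) → MKer (3 + 1) (Fib 3)} {RM : ℕ → (Fin (3 + 1) → ℤ) → Fin (3 + 1) → (Fin (3 + 1) → ℤ) → MKer (3 + 1) (Fib 3)}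
    (hcls0 : ∃ C δ : ℝ, 0 < δ ∧ (∀ Y, LocStencil (RW Y) C δ) ∧ (∀ Y, LocStencil (RW'' Y) C δ) ∧ (∀ Y, LocStencil (RB 0 Y) C δ) ∧
      (∀ Y, LocStencil (RB'' 0 Y) C δ) ∧ (∀ y, VertexFamily (RM 0 y) Lc C δ))
    (hclsS : ∀ j : ℕ, ∃ C δ : ℝ, 0 < δ ∧ (∀ Y, LocStencil (RB (j + 1) Y) C δ) ∧ (∀ Y, LocStencil (RB'' (j + 1) Y) C δ) ∧
      (∀ y, VertexFamily (RM (j + 1) y) Lc C δ))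
    (hRWp : ∀ Y κ u, trK (RW Y κ u) = -sgnK (RW Y κ u)) (hRW''p : ∀ Y κ u, trK (RW'' Y κ u) = -sgnK (RW'' Y κ u))
    (hRBp : ∀ j Y κ u, trK (RB j Y κ u) = -sgnK (RB j Y κ u)) (hRB''p : ∀ j Y κ u, trK (RB'' j Y κ u) = -sgnK (RB'' j Y κ u))
    (hRMp : ∀ j y ρ' w, trK (RM j y ρ' w) = -sgnK (RM j y ρ' w))
    (hWil : ∀ (Y : Fin (3 + 1) → ℤ) (κ' : Fin (3 + 1)) (u' : Fin (3 + 1) → ℤ),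
      (stepScale 3 Lc 0 * (Lc : ℝ) ^ (3 + 1))⁻¹ • ∑ v ∈ box (3 + 1) Lc, divV (fun κ u => cE₂ • wilsonW₂ 3 T κ u κ' u') ((Lc : ℤ) • Y + toSite v) =
        comp (((Lc : ℝ) ^ (3 + 1)) • wilsonA 3 κ' u') (diagK (((1 : ℝ) / 2) • ∑ v ∈ box (3 + 1) Lc, legInd (toSite r) ((Lc : ℤ) • Y + toSite v)))
          - comp (diagK (((1 : ℝ) / 2) • ∑ v ∈ box (3 + 1) Lc, legInd (toSite r) ((Lc : ℤ) • Y + toSite v))) (((Lc : ℝ) ^ (3 + 1)) • wilsonA 3 κ' u')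
          + RW Y κ' u')
    (hWil'' : ∀ (Y : Fin (3 + 1) → ℤ) (κ : Fin (3 + 1)) (u : Fin (3 + 1) → ℤ),
      (stepScale 3 Lc 0 * (Lc : ℝ) ^ (3 + 1))⁻¹ • ∑ v ∈ box (3 + 1) Lc, divV (fun κ' u' => cE₂ • wilsonW₂ 3 T κ u κ' u') ((Lc : ℤ) • Y + toSite v) =
        comp (((Lc : ℝ) ^ (3 + 1)) • wilsonA 3 κ u) (diagK (((1 : ℝ) / 2) • ∑ v ∈ box (3 + 1) Lc, legInd (toSite r) ((Lc : ℤ) • Y + toSite v)))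
          - comp (diagK (((1 : ℝ) / 2) • ∑ v ∈ box (3 + 1) Lc, legInd (toSite r) ((Lc : ℤ) • Y + toSite v))) (((Lc : ℝ) ^ (3 + 1)) • wilsonA 3 κ u)
          + RW'' Y κ u)
    (hBord0 : ∀ (Y : Fin (3 + 1) → ℤ) (κ' : Fin (3 + 1)) (u' : Fin (3 + 1) → ℤ),
      (stepScale 3 Lc 0 * (Lc : ℝ) ^ (3 + 1))⁻¹ • ∑ v ∈ box (3 + 1) Lc, divV (fun κ u => cB • vh₂S κ u κ' u') ((Lc : ℤ) • Y + toSite v) =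
        comp ((-((Lc : ℝ) ^ (3 + 1) * (1 / 2) * (Lc : ℝ) ^ (3 + 1))) • vhSAt (toSite r) 3 Lc rfl κ' u') (diagK (((1 : ℝ) / 2) • ∑ v ∈ box (3 + 1) Lc, legInd (toSite r) ((Lc : ℤ) • Y + toSite v)))
          - comp (diagK (((1 : ℝ) / 2) • ∑ v ∈ box (3 + 1) Lc, legInd (toSite r) ((Lc : ℤ) • Y + toSite v))) ((-((Lc : ℝ) ^ (3 + 1) * (1 / 2) * (Lc : ℝ) ^ (3 + 1))) • vhSAt (toSite r) 3 Lc rfl κ' u')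
          + RB 0 Y κ' u')
    (hBord0'' : ∀ (Y : Fin (3 + 1) → ℤ) (κ : Fin (3 + 1)) (u : Fin (3 + 1) → ℤ),
      (stepScale 3 Lc 0 * (Lc : ℝ) ^ (3 + 1))⁻¹ • ∑ v ∈ box (3 + 1) Lc, divV (fun κ' u' => cB • vh₂S κ u κ' u') ((Lc : ℤ) • Y + toSite v) =
        comp ((-((Lc : ℝ) ^ (3 + 1) * (1 / 2) * (Lc : ℝ) ^ (3 + 1))) • vhSAt (toSite r) 3 Lc rfl κ u) (diagK (((1 : ℝ) / 2) • ∑ v ∈ box (3 + 1) Lc, legInd (toSite r) ((Lc : ℤ) • Y + toSite v)))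
          - comp (diagK (((1 : ℝ) / 2) • ∑ v ∈ box (3 + 1) Lc, legInd (toSite r) ((Lc : ℤ) • Y + toSite v))) ((-((Lc : ℝ) ^ (3 + 1) * (1 / 2) * (Lc : ℝ) ^ (3 + 1))) • vhSAt (toSite r) 3 Lc rfl κ u)
          + RB'' 0 Y κ u)
    (hBordS : ∀ (j : ℕ) (Y : Fin (3 + 1) → ℤ) (κ' : Fin (3 + 1)) (u' : Fin (3 + 1) → ℤ),
      (stepScale 3 Lc (j + 1) * (Lc : ℝ) ^ (3 + 1))⁻¹ •
          ∑ v ∈ box (3 + 1) Lc, divV (fun κ u => (cB * wB2 3 Lc (j + 1)) • vh₂S κ u κ' u') ((Lc : ℤ) • Y + toSite v) =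
        comp ((-((Lc : ℝ) ^ (3 + 1) * (1 / 2) * (Lc : ℝ) ^ (3 + 1)) * wVH 3 Lc (j + 1)) • vhSAt (toSite r) 3 Lc rfl κ' u') (diagK (((1 : ℝ) / 2) • ∑ v ∈ box (3 + 1) Lc, legInd (toSite r) ((Lc : ℤ) • Y + toSite v)))
          - comp (diagK (((1 : ℝ) / 2) • ∑ v ∈ box (3 + 1) Lc, legInd (toSite r) ((Lc : ℤ) • Y + toSite v))) ((-((Lc : ℝ) ^ (3 + 1) * (1 / 2) * (Lc : ℝ) ^ (3 + 1)) * wVH 3 Lc (j + 1)) • vhSAt (toSite r) 3 Lc rfl κ' u')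
          + RB (j + 1) Y κ' u')
    (hBordS'' : ∀ (j : ℕ) (Y : Fin (3 + 1) → ℤ) (κ : Fin (3 + 1)) (u : Fin (3 + 1) → ℤ),
      (stepScale 3 Lc (j + 1) * (Lc : ℝ) ^ (3 + 1))⁻¹ •
          ∑ v ∈ box (3 + 1) Lc, divV (fun κ' u' => (cB * wB2 3 Lc (j + 1)) • vh₂S κ u κ' u') ((Lc : ℤ) • Y + toSite v) =
        comp ((-((Lc : ℝ) ^ (3 + 1) * (1 / 2) * (Lc : ℝ) ^ (3 + 1)) * wVH 3 Lc (j + 1)) • vhSAt (toSite r) 3 Lc rfl κ u) (diagK (((1 : ℝ) / 2) • ∑ v ∈ box (3 + 1) Lc, legInd (toSite r) ((Lc : ℤ) • Y + toSite v)))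
          - comp (diagK (((1 : ℝ) / 2) • ∑ v ∈ box (3 + 1) Lc, legInd (toSite r) ((Lc : ℤ) • Y + toSite v))) ((-((Lc : ℝ) ^ (3 + 1) * (1 / 2) * (Lc : ℝ) ^ (3 + 1)) * wVH 3 Lc (j + 1)) • vhSAt (toSite r) 3 Lc rfl κ u)
          + RB'' (j + 1) Y κ u)
    (hM₂ : ∀ (j : ℕ) (y : Fin (3 + 1) → ℤ) (ρ' : Fin (3 + 1)) (w : Fin (3 + 1) → ℤ),
      (stepScale 3 Lc j * (Lc : ℝ) ^ (3 + 1))⁻¹ • ∑ v ∈ box (3 + 1) Lc, divV (fun κ u => M2Of 3 Lc mixFF j κ u ρ' w) ((Lc : ℤ) • y + toSite v) =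
        comp (M1At 3 Lc (toSite r) cΛ j ρ' w) (diagK (((1 : ℝ) / 2) • ∑ v ∈ box (3 + 1) Lc, legInd (toSite r) ((Lc : ℤ) • y + toSite v)))
          - comp (diagK (((1 : ℝ) / 2) • ∑ v ∈ box (3 + 1) Lc, legInd (toSite r) ((Lc : ℤ) • y + toSite v))) (M1At 3 Lc (toSite r) cΛ j ρ' w)
          + RM j y ρ' w)
    (hBt : ∀ (κ : Fin (3 + 1)) (u : Fin (3 + 1) → ℤ) (κ' : Fin (3 + 1)) (u' t : Fin (3 + 1) → ℤ),
      vh₂S κ (u + (Lc : ℤ) • t) κ' (u' + (Lc : ℤ) • t) = shiftK (-((Lc : ℤ) • t)) (vh₂S κ u κ' u'))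
    (hmixt : ∀ (κ : Fin (3 + 1)) (u : Fin (3 + 1) → ℤ) (μ : Fin (3 + 1)) (w t : Fin (3 + 1) → ℤ),
      mixFF κ (u + (Lc : ℤ) • t) μ (w + t) = shiftK (-((Lc : ℤ) • t)) (mixFF κ u μ w)) :
    ∀ j : ℕ, WardTransversal (flipK (TbalOf Lc
      (JsRecWAtOf (d := 3) hLc hr ((Lc : ℝ) ^ (3 + 1)) (-((Lc : ℝ) ^ (3 + 1) * (1 / 2) * (Lc : ℝ) ^ (3 + 1))) cΛ cE₂ cB T hB hmix) j)) := by
  obtain ⟨Nr, hcls, hpar, hlaw⟩ := exists_kernelLaws_of_letters (d := 3) hLc hr cΛ cB hcE₂ T hB hmix hcls0 hclsS hRWp hRW''p hRBp hRB''p hRMp hWil hWil''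
    hBord0 hBord0'' hBordS hBordS'' hM₂
  exact wardTransversal_flipK_TbalOf_JsRecWAtOf_of_kernelLaws hLc hr cΛ cE₂ cB T hB hBt hmix hmixt Nr
    (fun j y ν y' => by obtain ⟨C, δ, hδ, h⟩ := hcls j; exact ⟨_, _, _, δ, hδ, h y ν y'⟩) hpar hlaw

end End

end Summit.QuantumFields.BalabanUV.Beta.WardLocusRecursiveLetters

end
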